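import Summits.ResolutionOfSingularities.ResolutionOfSingularities.Theorems.EquisingularLiftEquisingularLiftNatNestStepChainOfFact
import Summits.ResolutionOfSingularities.ResolutionOfSingularities.Theorems.EquisingularLiftEquisingularLiftNatHostTransportRound
import Summits.ResolutionOfSingularities.ResolutionOfSingularities.Theorems.EquisingularLiftEquisingularLiftNatTowerFrameSupply
import HarnessLib

/-!
# [OURS · L1 W4.5(b) · EL♮(3) · WIDTH TABLE D4 «HOSTED NOSE», brick D4-2 (S-HROUND)] THE HOSTED-ROUND SUPPLIER OF K5ʰ v2.2 FROM (T-k)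
# `TCPlus.hround_seam k hF : <HROUND₂ of target_elnat_of_hostedSubchainResolution₂ at n := 3, verbatim>`

res-L1-w45b-stub-2 g15 (desk `WIDTH TABLE D4`, R43 (4) order «HT2 ✓ → stub-2 hround → nose-w2 HSUBʰ → rung (R-ν3)»).  OURS; NOT a statement of any
manuscript ([Hironaka2017] is a candidate under adjudication, nothing of it is asserted); AI-written, weaker than expert review.  No `sorry`; standard
axioms; DEF-FREE; one NAMED-FACT hypothesis `hF : EmbeddedCurveLiftFact` (residue (T-k), res-L1-w45b-lead-2's `…NatTowerRoundFourDefs`; the registered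
stub of the skeleton of record carries it).  `--supports stmt-ResolutionOfSingularities-20148 --as helper`.

WHAT.  The HROUND₂ hypothesis of this seat's engine `target_elnat_of_hostedSubchainResolution₂` (✓ `…NatHostedSubchainPointResolution2`), AT `n := 3`,
stated VERBATIM and discharged from (T-k): in the engine's context (base `q : P ⟶ Spec O` smooth of relative dimension 3, abstract stage predicate `Ch`
closed under E1-legal regular `O`-flat centres and implying `Split.Chain`), at a `Ch`-stage `(X', σ', S')` with model square `j : F₁ ⟶ X'` over `Spec θ`,
`j '' T₁ = S'`, and a host letter `E₁` with res-type-027's `TCPlus.LetterDatum O P q Y F₁ X' σ' j E₁` (model `𝓔`: reduced trace `𝓘⟨closure E₁⟩`,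
principal, regular, off `Y`, `O`-flat): every closed CURVE `Z ⊆ closure E₁ ∩ T₁`, `T₁ ⊄ Z`, with `Z̃` regular, `Ẽ₁` regular along `Z̃`,
`DirStepUnobs F₁ (closure E₁) _ Z hZ` and `dim 𝒪_{Z̃,z} = 1` at closed points, and its blow-up `υ' : F₃ ⟶ F₁`, are matched by a `Ch`-stage
`(X₉, σ₉, S₉)` with a model square `j₉ : F₃ ⟶ X₉`, `j₉ '' St T₁ = S₉`, `St T₁` irreducible, `F₃` integral, AND a host letter for `St (closure E₁)`.

PROOF (pure composition, ≈ 60 lines).  (T-k) = `hF k O θ hθ P q X' σ' 𝓔` at the host's model gives the centre `C ⊇ 𝓔`, regular, `O`-flat, trace `𝓘⟨Z⟩`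
(as in ✓ `nestRound_chain_of_fact`, but the centre is KEPT IN HAND — res-L1-w45b-crit-2 (G1)); E1-legality off `Y` =
`image_support_subset_not_isGenericPoint_of_chain`; `X₉ := Bl_C X'` (`exists_isBlowup`) with its `Ch`-stage, invariants and model square (`modelStep_chain`:
`hsq₃`, `j₃ ≫ τ₃ = υ' ≫ j`, irreducible strict transform, `F₃` integral); the 2-frames of `C` = `hFrame_of_ringKrullDim_redSub` (this is where
`dim 𝒪_{Z̃,z} = 1` and `n = 3` enter); `𝓔 ≠ ⊥` by (l-iv) and `Chain.fibre`; the host letter of the strict transform = res-L1-w45b-stub-4's ★ (HT2′)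
`TCPlus.letterDatum_transport_hostedRound'` at `E := closure E₁` (its cartesian square is derived inside from `hsq₃` + commutation, crit-2 (G2)).
[folklore; pure composition of ✓ p658608's ingredients, ✓ `hFrame_of_ringKrullDim_redSub`, ✓ HT2′]
-/

set_option linter.dupNamespace false -- mandated namespace `Summit.<Summit>.<Problem>` of this single-conjunct summit
set_option linter.overlappingInstances false -- signatures carry `[IsDomain O] [IsDiscreteValuationRing O]`

noncomputable section

open CategoryTheory CategoryTheory.Limits AlgebraicGeometry TopologicalSpace Topology IsLocalRing
open Literature.AlgebraicGeometry.Resolution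
open AlgebraicGeometry.Scheme.IdealSheafData
open Summit.ResolutionOfSingularities.ResolutionOfSingularities.Theses.EquisingularLift.Split
open Summit.ResolutionOfSingularities.ResolutionOfSingularities.Cruxes.EquisingularLift.StrataSplit

namespace Summit.ResolutionOfSingularities.ResolutionOfSingularities.Cruxes.EquisingularLiftNat.Sections

/-- **S-HROUND: the hosted-round supplier HROUND₂ of K5ʰ v2.2 at `n = 3`, from (T-k).**  The type is the engine's HROUND₂ hypothesis VERBATIM with
`n := 3` (see the module docstring for the reading and the proof). [folklore; pure composition] [OURS · L1 W4.5b · WIDTH TABLE D4 brick D4-2] -/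
theorem TCPlus.hround_seam (k : Type) [Field k] [IsAlgClosed k] (hF : EmbeddedCurveLiftFact) :
    ∀ (O : Type) [CommRing O] [IsDomain O] [IsDiscreteValuationRing O] [IsAdicComplete (IsLocalRing.maximalIdeal O) O]
        [IsAlgClosed (IsLocalRing.ResidueField O)] (θ : O →+* k), Function.Surjective θ →
      ∀ (P : AlgebraicGeometry.Scheme.{0}) (q : P ⟶ AlgebraicGeometry.Spec (.of O)) (Y : Set P)
        (Ch : ∀ X' : AlgebraicGeometry.Scheme.{0}, (X' ⟶ P) → Set X' → Prop),
        (∀ (X' X'' : AlgebraicGeometry.Scheme.{0}) (σ' : X' ⟶ P) (S' : Set X') (C : X'.IdealSheafData) (τ : X'' ⟶ X'),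
          Ch X' σ' S' → Literature.AlgebraicGeometry.Resolution.IsBlowup τ C →
          Literature.AlgebraicGeometry.Resolution.Scheme.IsRegular C.subscheme → AlgebraicGeometry.Flat (C.subschemeι ≫ σ' ≫ q) →
          σ' '' (C.support : Set X') ⊆ {y | ¬ IsGenericPoint y Y} →
          (C.support : Set X') ∩ (σ' ≫ q) ⁻¹' {IsLocalRing.closedPoint O} ⊆ S' →
          Ch X'' (τ ≫ σ') (closure (τ ⁻¹' (S' \ (C.support : Set X'))))) →
        (∀ (X' : AlgebraicGeometry.Scheme.{0}) (σ' : X' ⟶ P) (S' : Set X'), Ch X' σ' S' →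
          Summit.ResolutionOfSingularities.ResolutionOfSingularities.Theses.EquisingularLift.Split.Chain P Y X' σ' S') →
        Y ⊆ q ⁻¹' {IsLocalRing.closedPoint O} → IsIrreducible Y → IsClosed Y →
        AlgebraicGeometry.IsIntegral P → IsLocallyNoetherian P → Literature.AlgebraicGeometry.Resolution.Scheme.IsRegular P →
        AlgebraicGeometry.IsProper q → AlgebraicGeometry.SmoothOfRelativeDimension 3 q →
      ∀ (X' : AlgebraicGeometry.Scheme.{0}) (σ' : X' ⟶ P) (S' : Set X'), Ch X' σ' S' → AlgebraicGeometry.IsIntegral X' →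
        IsLocallyNoetherian X' → Literature.AlgebraicGeometry.Resolution.Scheme.IsRegular X' →
        AlgebraicGeometry.IsDominant (σ' ≫ q) →
      ∀ (F₁ : AlgebraicGeometry.Scheme.{0}), AlgebraicGeometry.IsIntegral F₁ → ∀ (j : F₁ ⟶ X')
        (t : F₁ ⟶ AlgebraicGeometry.Spec (.of k)),
        IsPullback j t (σ' ≫ q) (AlgebraicGeometry.Spec.map (CommRingCat.ofHom θ)) →
      ∀ (T₁ : Set F₁), IsClosed T₁ → IsIrreducible T₁ → j '' T₁ = S' →
      ∀ (E₁ : Set F₁), TCPlus.LetterDatum O P q Y F₁ X' σ' j E₁ →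
      ∀ (Z : Set F₁) (hZ : IsClosed Z) (F₃ : AlgebraicGeometry.Scheme.{0}) (υ' : F₃ ⟶ F₁),
        Z ⊆ closure E₁ → Z ⊆ T₁ → ¬ T₁ ⊆ Z →
        (∀ z : ↥(redSub F₁ Z hZ), IsRegularLocalRing ((redSub F₁ Z hZ).presheaf.stalk z)) →
        (∀ (i : redSub F₁ Z hZ ⟶ redSub F₁ (closure E₁) isClosed_closure), i ≫ redSubι F₁ (closure E₁) isClosed_closure = redSubι F₁ Z hZ →
          ∀ z : ↥(redSub F₁ Z hZ), IsRegularLocalRing ((redSub F₁ (closure E₁) isClosed_closure).presheaf.stalk (i z))) →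
        DirStepUnobs F₁ (closure E₁) isClosed_closure Z hZ →
        (∀ z : ↥(redSub F₁ Z hZ), IsClosed ({z} : Set ↥(redSub F₁ Z hZ)) → ringKrullDim ((redSub F₁ Z hZ).presheaf.stalk z) = ((1 : ℕ) : WithBot ℕ∞)) →
        Literature.AlgebraicGeometry.Resolution.IsBlowup υ' (AlgebraicGeometry.Scheme.IdealSheafData.vanishingIdeal (⟨Z, hZ⟩ : TopologicalSpace.Closeds F₁)) →
        ∃ (X₉ : AlgebraicGeometry.Scheme.{0}) (σ₉ : X₉ ⟶ P) (S₉ : Set X₉) (j₉ : F₃ ⟶ X₉) (t₉ : F₃ ⟶ AlgebraicGeometry.Spec (.of k)),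
          Ch X₉ σ₉ S₉ ∧ AlgebraicGeometry.IsIntegral X₉ ∧ IsLocallyNoetherian X₉ ∧
          Literature.AlgebraicGeometry.Resolution.Scheme.IsRegular X₉ ∧ AlgebraicGeometry.IsDominant (σ₉ ≫ q) ∧
          IsPullback j₉ t₉ (σ₉ ≫ q) (AlgebraicGeometry.Spec.map (CommRingCat.ofHom θ)) ∧ j₉ '' (closure (υ' ⁻¹' (T₁ \ Z))) = S₉ ∧
          IsIrreducible (closure (υ' ⁻¹' (T₁ \ Z))) ∧ AlgebraicGeometry.IsIntegral F₃ ∧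
          TCPlus.LetterDatum O P q Y F₃ X₉ σ₉ j₉ (closure (υ' ⁻¹' (closure E₁ \ Z))) := by
  intro O _ _ _ _ _ θ hθ P q Y Ch hChStep hChSplit hYsp hYirr hYcl hPint hPnoeth hPreg hqprop hqsm X' σ' S' hCh' hX'int hX'noeth hX'reg hX'dom
    F₁ hF₁ j t hsq T₁ hT₁cl hT₁irr hjT₁ E₁ hL Z hZ F₃ υ' hZE hZT hTZ hZreg hEreg hunobs hZdim hυ'
  classical
  haveI := hPint; haveI := hPnoeth; haveI := hX'int; haveI := hX'noeth; haveI := hF₁; haveI := hqprop; haveI := hqsm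
  obtain ⟨𝓔, hEtr, hEpr, hEreg', hEoff, hEfl⟩ := hL
  -- properness of the stage over `O` (for (T-k)'s properness input)
  have hch : Chain P Y X' σ' S' := hChSplit _ _ _ hCh'
  obtain ⟨-, -, hσ'prop⟩ := chain_isRegular P Y X' σ' S' hch hPnoeth hPreg
  haveI := hσ'prop
  have hEprop : IsProper (𝓔.subschemeι ≫ σ' ≫ q) := inferInstance
  -- the host's model is not `⊥`: (l-iv) and the fibre of the chain over the generic point of `Y`
  have h𝓔0 : 𝓔 ≠ ⊥ := by
    obtain ⟨ξ, hξ⟩ : ∃ ξ : P, IsGenericPoint ξ Y := QuasiSober.sober hYirr hYcl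
    obtain ⟨ξ', hfib', -⟩ := Chain.fibre hch hξ
    intro h0
    have hmem : ξ' ∈ (𝓔.support : Set X') := by rw [h0, Scheme.IdealSheafData.support_bot]; trivial
    have hgen : σ' ξ' = ξ := by
      have : ξ' ∈ σ' ⁻¹' {ξ} := by rw [hfib']; exact Set.mem_singleton ξ'
      exact this
    exact hEoff ⟨ξ', hmem, rfl⟩ (hgen ▸ hξ)
  -- (T-k) AT THE HOST'S MODEL: the centre `C ⊇ 𝓔`, kept in hand
  obtain ⟨C, hEC, hCreg, hCfl, hCj, -⟩ := hF k O θ hθ P q X' σ' 𝓔 hX'int hX'noeth hX'reg hEreg' hEfl hEprop F₁ j t hsq (closure E₁)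
    isClosed_closure hEtr Z hZ hZE hZreg hEreg hunobs
  -- E1-legality of `C` upstairs: off the generic point of `Y`
  have hoff : σ' '' (C.support : Set X') ⊆ {y : P | ¬ IsGenericPoint y Y} :=
    image_support_subset_not_isGenericPoint_of_chain θ hθ q Y hYsp σ' S' hch j t hsq T₁ hjT₁ C Z hZ hCj hTZ
  -- the blow-up of `C`, its `Ch`-stage and the model square for `υ'`
  have hDT : (((vanishingIdeal (⟨Z, hZ⟩ : Closeds F₁)) : F₁.IdealSheafData).support : Set F₁) ⊆ T₁ := by
    rw [Scheme.IdealSheafData.coe_support_vanishingIdeal]; exact hZT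
  have hTD : ¬ T₁ ⊆ (((vanishingIdeal (⟨Z, hZ⟩ : Closeds F₁)) : F₁.IdealSheafData).support : Set F₁) := by
    rw [Scheme.IdealSheafData.coe_support_vanishingIdeal]; exact hTZ
  obtain ⟨X₃, τ₃, hτ₃⟩ := exists_isBlowup X' C
  obtain ⟨hX₃i, hX₃n, hX₃r, hX₃dom, hF₃i, hirr₃, j₃, t₃, hsq₃, hcomm₃, hCh₃⟩ :=
    modelStep_chain O k θ hθ P q Y hYirr hYcl Ch hChSplit hChStep X' σ' S' hCh' hX'reg hX'dom F₁ j t hsq T₁ hjT₁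
      C (vanishingIdeal (⟨Z, hZ⟩ : Closeds F₁)) hCj hCreg hCfl hoff hDT hTD X₃ τ₃ hτ₃ F₃ υ' hυ'
  rw [Scheme.IdealSheafData.coe_support_vanishingIdeal] at hirr₃ hCh₃
  haveI := hX₃n
  -- the 2-frames of `C` (the curve clause and `n = 3`)
  have hfr : ∀ x ∈ C.support, ∃ c : Fin 2 → X'.presheaf.stalk x, Ideal.span (Set.range c) = stalkIdeal C x ∧ IsQuasiRegular c :=
    hFrame_of_ringKrullDim_redSub O k θ hθ P q Y hYirr hYcl hPnoeth hPreg Ch hChSplit T₁ Z hZ hZdim X' σ' S' j t C hCh' hX'int hX'noeth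
      hX'reg hX'dom hsq hjT₁ hCj hCfl hCreg
  -- the host letter of the strict transform (HT2′)
  have hL₉ : TCPlus.LetterDatum O P q Y F₃ X₃ (τ₃ ≫ σ') j₃ (closure (υ' ⁻¹' (closure E₁ \ Z))) :=
    TCPlus.letterDatum_transport_hostedRound' O k θ hθ q Y σ' hX'reg j t hsq isClosed_closure 𝓔 hEtr hEpr hEreg' hEoff hEfl h𝓔0 C hEC hZ
      hCj hCfl hCreg hfr hτ₃ hυ' j₃ t₃ hsq₃ hcomm₃
  exact ⟨X₃, τ₃ ≫ σ', _, j₃, t₃, hCh₃, hX₃i, hX₃n, hX₃r, hX₃dom, hsq₃, rfl, hirr₃, hF₃i, hL₉⟩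

end Summit.ResolutionOfSingularities.ResolutionOfSingularities.Cruxes.EquisingularLiftNat.Sections

end
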